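import Summits.Langlands.Langlands.Theses.ParityBlindBianchi
import Summits.Langlands.Langlands.Theorems.IrreducibilityBySelfDualityIrreducibleGL3CMContinuousSemisimplification
import Summits.Langlands.Langlands.Theorems.IrreducibilityBySelfDualityIrreducibleGL3CMReducibleCompanion
import Literature.NumberTheory.GaloisRepresentations.LAdicRepFrobenius
import Literature.NumberTheory.GaloisRepresentations.FramedRepEquivConj
import Literature.NumberTheory.Automorphic.ChebotarevArtinRepHolds
import Literature.NumberTheory.Automorphic.AutomorphicRepsGLSatakeFlathProofs
import HarnessLib

/-!
# Sketch — BC2 REDIRECT of `ParityBlindBianchi.EvenArtinJunction` (stmt-Langlands-2908), BY NAME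
(crux-strategist planner-cstrat-stmt-Langlands-2908-r1-0, 2026-08-17)

Part 1: the four children of the split, as `def`s in the ROUTE FILE context (namespace
`Summit.Langlands.Langlands.Theses.ParityBlindBianchi`, same `open` lines as the gate renders) — these are
the `statement` texts of `children.json`, letter for letter.
Part 2: a verbatim copy of the structural glue `Glue.lean` (`evenArtinJunction_of_leaves`, texts only).
Part 3: the BY-NAME certificate `EvenArtinJunction_of_subs :
ReciprocityDataNonempty → WeakExistenceIrreducible → WeakAutomorphy → PairCompatibilityAll → EvenArtinJunction`,
proved by `exact evenArtinJunction_of_leaves` (δ-unfolding only): the texts ARE the decls, and the route's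
glue item `EvenArtinJunctionOfLeaves` (generated by `route edit --split … --glue`) is closed by this term once
the children are in the route file (a prover deletes Part 1 and re-targets).  lean check: rc 0, 0 sorries.
-/

noncomputable section

set_option linter.dupNamespace false

/-! ## Part 1 — the children (route-file context) -/

namespace Summit.Langlands.Langlands.Theses.ParityBlindBianchi

open scoped BigOperators Topology Manifold Classical MeasureTheory ProbabilityTheory Matrix InnerProductSpace ComplexConjugate ContinuousMap
open Filter Set Function TopologicalSpace MeasureTheory

/-- N — reciprocity data exist over every number field (support; Harris–Taylor/Henniart + canonical pins). -/
def ReciprocityDataNonempty : Prop :=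
  ∀ (K : Type) [Field K] [NumberField K], Nonempty (ReciprocityData K)

/-- W_irr — weak existence with irreducibility (Buzzard–Gee 3.2.2 / Taylor Conj. (A), weak, `𝓡`-free). -/
def WeakExistenceIrreducible : Prop :=
  ∀ (K : Type) [Field K] [NumberField K] (n : ℕ) (hcpt : Literature.NumberTheory.Automorphic.isCompact_glFiniteIntegralLevel n K), 0 < n → ∀ π : Literature.NumberTheory.Automorphic.CuspidalAutomorphicRepData n K hcpt, π.1.IsLAlgebraic → ∀ (ℓ : ℕ) [Fact ℓ.Prime] (ι : PadicAlgCl ℓ ≃+* ℂ), ∃ ρ : Literature.NumberTheory.GaloisRepresentations.FramedGaloisRep K (PadicAlgCl ℓ) n, ρ.toGaloisRep.IsIrreducible ∧ ((∀ᶠ v : IsDedekindDomain.HeightOneSpectrum (NumberField.RingOfIntegers K) in cofinite, ρ.IsUnramifiedAt v) ∧ ∀ (v : IsDedekindDomain.HeightOneSpectrum (NumberField.RingOfIntegers K)) (hv : ((ℓ : ℕ) : NumberField.RingOfIntegers K) ∈ v.asIdeal), (Literature.NumberTheory.PAdicHodge.fontainePstAdicCompletion v ℓ hv).IsDeRhamFramed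 (ρ.toLocal v)) ∧ ∀ᶠ v : IsDedekindDomain.HeightOneSpectrum (NumberField.RingOfIntegers K) in cofinite, SatakeFrobCompatibleAt ι π.1 ρ v

/-- B_w — weak automorphy (Fontaine–Mazur–Langlands, a.e. form; verbatim the 10368 child text). -/
def WeakAutomorphy : Prop :=
  ∀ (K : Type) [Field K] [NumberField K] (n : ℕ) (hcpt : Literature.NumberTheory.Automorphic.isCompact_glFiniteIntegralLevel n K), 0 < n → ∀ (ℓ : ℕ) [Fact ℓ.Prime] (ι : PadicAlgCl ℓ ≃+* ℂ) (ρ : Literature.NumberTheory.GaloisRepresentations.FramedGaloisRep K (PadicAlgCl ℓ) n), ρ.toGaloisRep.IsIrreducible → ((∀ᶠ v : IsDedekindDomain.HeightOneSpectrum (NumberField.RingOfIntegers K) in cofinite, ρ.IsUnramifiedAt v) ∧ ∀ (v : IsDedekindDomain.HeightOneSpectrum (NumberField.RingOfIntegers K)) (hv : ((ℓ : ℕ) : NumberField.RingOfIntegers K) ∈ v.asIdeal), (Literature.NumberTheory.PAdicHodge.fontainePstAdicCompletion v ℓ hv).IsDeRhamFramed (ρ.toLocal v)) → ∃ π : Literature.NumberTheory.Automorphic.CuspidalAutomorphicRepData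 n K hcpt, π.1.IsLAlgebraic ∧ ∀ᶠ v : IsDedekindDomain.HeightOneSpectrum (NumberField.RingOfIntegers K) in cofinite, SatakeFrobCompatibleAt ι π.1 ρ v

/-- C∀ — local–global compatibility for irreducible pinned-geometric a.e.-compatible pairs, ALL data `𝓡`. -/
def PairCompatibilityAll : Prop :=
  ∀ (K : Type) [Field K] [NumberField K] (Rec : ReciprocityData K) (n : ℕ) (hcpt : Literature.NumberTheory.Automorphic.isCompact_glFiniteIntegralLevel n K), 0 < n → ∀ (π : Literature.NumberTheory.Automorphic.CuspidalAutomorphicRepData n K hcpt), π.1.IsLAlgebraic → ∀ (ℓ : ℕ) [Fact ℓ.Prime] (ι : PadicAlgCl ℓ ≃+* ℂ) (ρ : Literature.NumberTheory.GaloisRepresentations.FramedGaloisRep K (PadicAlgCl ℓ) n), ρ.toGaloisRep.IsIrreducible → ((∀ᶠ v : IsDedekindDomain.HeightOneSpectrum (NumberField.RingOfIntegers K) in cofinite, ρ.IsUnramifiedAt v) ∧ ∀ (v : IsDedekindDomain.HeightOneSpectrum (NumberField.RingOfIntegers K)) (hv : ((ℓ : ℕ) : NumberField.RingOfIntegers K)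 ∈ v.asIdeal), (Literature.NumberTheory.PAdicHodge.fontainePstAdicCompletion v ℓ hv).IsDeRhamFramed (ρ.toLocal v)) → (∀ᶠ v : IsDedekindDomain.HeightOneSpectrum (NumberField.RingOfIntegers K) in cofinite, SatakeFrobCompatibleAt ι π.1 ρ v) → ∀ v : IsDedekindDomain.HeightOneSpectrum (NumberField.RingOfIntegers K), LocalGlobalCompatibleAt Rec ι π.1 ρ v

end Summit.Langlands.Langlands.Theses.ParityBlindBianchi

/-! ## Part 2 — structural glue (copy of Glue.lean) -/

open scoped NumberField Classical
open Filter IsDedekindDomain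
open Literature.NumberTheory.Automorphic Literature.NumberTheory.GaloisRepresentations
open Summit.Langlands

namespace Summit.Langlands.Langlands.Theorems.ParityBlindBianchiEvenArtinJunctionSplitSketch

variable {n : ℕ} {K : Type} [Field K] [NumberField K] {hcpt : isCompact_glFiniteIntegralLevel n K}
  {ℓ : ℕ} [Fact ℓ.Prime]

omit [NumberField K] in
/-- An irreducible continuous Galois representation on `ℚ̄_ℓⁿ` is semisimple (a simple lattice of
subrepresentations is complemented). [folklore] -/
theorem isSemisimple_of_isIrreducible (ρ : FramedGaloisRep K (PadicAlgCl ℓ) n)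
    (h : ρ.toGaloisRep.IsIrreducible) : ρ.toGaloisRep.IsSemisimple := by
  haveI := h
  change ComplementedLattice _
  infer_instance

omit [NumberField K] in
/-- Conjugate framed representations have the same characteristic polynomials
(Mathlib `Matrix.charpoly_units_conj`). [folklore] -/
theorem charpoly_conj (P : GL (Fin n) (PadicAlgCl ℓ)) (ρ : FramedGaloisRep K (PadicAlgCl ℓ) n)
    (g : Field.absoluteGaloisGroup K) :
    FramedRep.charpoly (ρ.conj P) g = FramedRep.charpoly ρ g := by
  simp only [FramedRep.charpoly, FramedRep.conj_apply, Units.val_mul, Matrix.coe_units_inv]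
  exact Matrix.charpoly_units_conj P _

/-- **Two avatars of one `π` have equal Frobenius characteristic polynomials almost everywhere**
(uniqueness of Satake parameters, Flath 1979 Thm. 3: `hasSatakeParamAt_unique_holds`). [folklore] -/
theorem eventually_hasFrobCharpolyAt_common
    (π : AutomorphicRepData (AutomorphyDatum.gl n K hcpt)) (ι : PadicAlgCl ℓ ≃+* ℂ)
    {ρ₀ r : FramedGaloisRep K (PadicAlgCl ℓ) n}
    (h₀ : ∀ᶠ v : HeightOneSpectrum (𝓞 K) in cofinite, SatakeFrobCompatibleAt ι π ρ₀ v)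
    (hr : ∀ᶠ v : HeightOneSpectrum (𝓞 K) in cofinite, SatakeFrobCompatibleAt ι π r v) :
    ∀ᶠ v : HeightOneSpectrum (𝓞 K) in cofinite,
      ρ₀.IsUnramifiedAt v ∧ r.IsUnramifiedAt v ∧
        ∃ P : Polynomial (PadicAlgCl ℓ), ρ₀.HasFrobCharpolyAt v P ∧ r.HasFrobCharpolyAt v P := by
  filter_upwards [h₀, hr] with v hv hv'
  obtain ⟨α, hα, hur, hcp⟩ := hv
  obtain ⟨α', hα', hur', hcp'⟩ := hv'
  obtain rfl : α = α' := AutomorphicRepData.hasSatakeParamAt_unique_holds π hα hα'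
  exact ⟨hur, hur', _, hcp, hcp'⟩

/-- **Chebotarev–Brauer–Nesbitt transfer of irreducibility** (every rank, every number field): if
`ρ₀, ρ : Γ_K →ₜ* GL_n(ℚ̄_ℓ)` are unramified with a COMMON Frobenius characteristic polynomial at all but
finitely many places and `ρ₀` is irreducible, then `ρ` is irreducible — a continuous semisimplification
`r` of `ρ` is equivalent to `ρ₀` (Deligne–Serre 1974, Lemme 3.2), hence conjugate to it, so `ρ` and `ρ₀`
have the same characteristic polynomials everywhere, and Brauer–Nesbitt. (Inlined from the
`IrreducibleOffSector` transfer module, which is in drift after D-0032 §4c.)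
[cite: DeligneSerreASENS1974, Lemme 3.2] -/
theorem isIrreducible_of_eventually_hasFrobCharpolyAt_common
    {ρ₀ ρ : FramedGaloisRep K (PadicAlgCl ℓ) n} (hirr₀ : ρ₀.toGaloisRep.IsIrreducible)
    (h : ∀ᶠ v : HeightOneSpectrum (𝓞 K) in cofinite,
      ρ₀.IsUnramifiedAt v ∧ ρ.IsUnramifiedAt v ∧
        ∃ P : Polynomial (PadicAlgCl ℓ), ρ₀.HasFrobCharpolyAt v P ∧ ρ.HasFrobCharpolyAt v P) :
    ρ.toGaloisRep.IsIrreducible := by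
  obtain ⟨r, hrss, hrcp, hrker⟩ := IrreducibleGL3CM.stub_continuousSemisimplification K ℓ n ρ
  have hr : ∀ᶠ v : HeightOneSpectrum (𝓞 K) in cofinite,
      ρ₀.IsUnramifiedAt v ∧ r.IsUnramifiedAt v ∧
        ∃ P : Polynomial (PadicAlgCl ℓ), ρ₀.HasFrobCharpolyAt v P ∧ r.HasFrobCharpolyAt v P := by
    filter_upwards [h] with v hv
    obtain ⟨hur₀, hur, P, hcp₀, hcp⟩ := hv
    exact ⟨hur₀, fun 𝔓 h𝔓 σ hσ => hrker σ (hur 𝔓 h𝔓 σ hσ), P, hcp₀,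
      fun 𝔓 h𝔓 σ hσ => (hrcp σ).trans (hcp 𝔓 h𝔓 σ hσ)⟩
  obtain ⟨e⟩ := FramedGaloisRep.nonempty_equiv_of_hasFrobCharpolyAt_eventually
    chebotarev_artinRep_holds ρ₀ r (isSemisimple_of_isIrreducible ρ₀ hirr₀) hrss hr
  obtain ⟨P, hP⟩ := FramedRep.exists_eq_conj_of_equiv ρ₀ r e
  have hcp : ∀ g, FramedRep.charpoly ρ₀ g = FramedRep.charpoly ρ g := fun g => by
    rw [← hrcp g, hP, charpoly_conj]
  by_contra hirr
  exact IrreducibleGL3CM.stub_not_isIrreducible_of_charpoly_eq K ℓ n ρ ρ₀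
    (isSemisimple_of_isIrreducible ρ₀ hirr₀) hcp hirr hirr₀

/-- **Uniqueness up to conjugacy of the avatar** (the last clause of (A)): if `ρ` is irreducible and
`ρ, ρ'` are both Satake–Frobenius compatible with `(π, ι)` at almost all places, then `ρ'` is a
`GL_n(ℚ̄_ℓ)`-conjugate of `ρ` — `ρ'` is irreducible by the transfer above, both are semisimple with equal
Frobenius polynomials a.e., hence equivalent (Chebotarev + Brauer–Nesbitt) and conjugate.
[cite: DeligneSerreASENS1974, Lemme 3.2] -/
theorem isConjugate_of_satakeFrobCompatible
    (π : AutomorphicRepData (AutomorphyDatum.gl n K hcpt)) (ι : PadicAlgCl ℓ ≃+* ℂ)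
    {ρ ρ' : FramedGaloisRep K (PadicAlgCl ℓ) n} (hirr : ρ.toGaloisRep.IsIrreducible)
    (hρ : ∀ᶠ v : HeightOneSpectrum (𝓞 K) in cofinite, SatakeFrobCompatibleAt ι π ρ v)
    (hρ' : ∀ᶠ v : HeightOneSpectrum (𝓞 K) in cofinite, SatakeFrobCompatibleAt ι π ρ' v) :
    IsConjugate ρ ρ' := by
  have hev := eventually_hasFrobCharpolyAt_common π ι hρ hρ'
  have hirr' : ρ'.toGaloisRep.IsIrreducible :=
    isIrreducible_of_eventually_hasFrobCharpolyAt_common hirr hev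
  obtain ⟨e⟩ := FramedGaloisRep.nonempty_equiv_of_hasFrobCharpolyAt_eventually
    chebotarev_artinRep_holds ρ ρ' (isSemisimple_of_isIrreducible ρ hirr)
    (isSemisimple_of_isIrreducible ρ' hirr') hev
  obtain ⟨P, hP⟩ := FramedRep.exists_eq_conj_of_equiv ρ ρ' e
  exact ⟨P, hP.symm⟩

/-- **`EvenArtinJunction` from its four leaves N, W_irr, B_w, C∀** (texts verbatim; the antecedent X of
the conclusion is discarded — module docstring (iv)).  Proof: at every number field `F`, N gives the
non-vacuity conjunct; for every reciprocity datum `𝓡`, direction (A) is W_irr + C∀ with uniqueness up to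
conjugacy by `isConjugate_of_satakeFrobCompatible`, and direction (B) is B_w + C∀ (the pinned Fontaine
datum makes `IsGeometricFramed 𝓡 ρ` definitionally the `𝓡`-free geometric clause of the leaves).
[cite: BuzzardGeeLMS2014, Conj. 3.2.1 and Conj. 3.2.2] [cite: FontaineMazurGeometric1995, Conj. 1]
[cite: HarrisTaylorAMS2001, Thm. A] [cite: DeligneSerreASENS1974, Lemme 3.2] -/
theorem evenArtinJunction_of_leaves :
    (∀ (K : Type) [Field K] [NumberField K], Nonempty (ReciprocityData K)) →
    (∀ (K : Type) [Field K] [NumberField K] (n : ℕ) (hcpt : Literature.NumberTheory.Automorphic.isCompact_glFiniteIntegralLevel n K), 0 < n → ∀ π : Literature.NumberTheory.Automorphic.CuspidalAutomorphicRepData n K hcpt, π.1.IsLAlgebraic → ∀ (ℓ : ℕ) [Fact ℓ.Prime] (ι : PadicAlgCl ℓ ≃+* ℂ), ∃ ρ : Literature.NumberTheory.GaloisRepresentations.FramedGaloisRep K (PadicAlgCl ℓ) n, ρ.toGaloisRep.IsIrreducible ∧ ((∀ᶠ v : IsDedekindDomain.HeightOneSpectrum (NumberField.RingOfIntegers K)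 in cofinite, ρ.IsUnramifiedAt v) ∧ ∀ (v : IsDedekindDomain.HeightOneSpectrum (NumberField.RingOfIntegers K)) (hv : ((ℓ : ℕ) : NumberField.RingOfIntegers K) ∈ v.asIdeal), (Literature.NumberTheory.PAdicHodge.fontainePstAdicCompletion v ℓ hv).IsDeRhamFramed (ρ.toLocal v)) ∧ ∀ᶠ v : IsDedekindDomain.HeightOneSpectrum (NumberField.RingOfIntegers K) in cofinite, SatakeFrobCompatibleAt ι π.1 ρ v) →
    (∀ (K : Type) [Field K] [NumberField K] (n : ℕ) (hcpt : Literature.NumberTheory.Automorphic.isCompact_glFiniteIntegralLevel n K), 0 < n → ∀ (ℓ : ℕ) [Fact ℓ.Prime] (ι : PadicAlgCl ℓ ≃+* ℂ) (ρ : Literature.NumberTheory.GaloisRepresentations.FramedGaloisRep K (PadicAlgCl ℓ) n), ρ.toGaloisRep.IsIrreducible → ((∀ᶠ v : IsDedekindDomain.HeightOneSpectrum (NumberField.RingOfIntegers K) in cofinite, ρ.IsUnramifiedAt v) ∧ ∀ (v : IsDedekindDomain.HeightOneSpectrum (NumberField.RingOfIntegers K)) (hv : ((ℓ : ℕ) :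 NumberField.RingOfIntegers K) ∈ v.asIdeal), (Literature.NumberTheory.PAdicHodge.fontainePstAdicCompletion v ℓ hv).IsDeRhamFramed (ρ.toLocal v)) → ∃ π : Literature.NumberTheory.Automorphic.CuspidalAutomorphicRepData n K hcpt, π.1.IsLAlgebraic ∧ ∀ᶠ v : IsDedekindDomain.HeightOneSpectrum (NumberField.RingOfIntegers K) in cofinite, SatakeFrobCompatibleAt ι π.1 ρ v) →
    (∀ (K : Type) [Field K] [NumberField K] (Rec : ReciprocityData K) (n : ℕ) (hcpt : Literature.NumberTheory.Automorphic.isCompact_glFiniteIntegralLevel n K), 0 < n → ∀ (π : Literature.NumberTheory.Automorphic.CuspidalAutomorphicRepData n K hcpt), π.1.IsLAlgebraic → ∀ (ℓ : ℕ) [Fact ℓ.Prime] (ι : PadicAlgCl ℓ ≃+* ℂ) (ρ : Literature.NumberTheory.GaloisRepresentations.FramedGaloisRep K (PadicAlgCl ℓ) n), ρ.toGaloisRep.IsIrreducible → ((∀ᶠ v : IsDedekindDomain.HeightOneSpectrum (NumberField.RingOfIntegers K) in cofinite, ρ.IsUnramifiedAt v) ∧ ∀ (v : IsDedekindDomain.HeightOneSpectrum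 (NumberField.RingOfIntegers K)) (hv : ((ℓ : ℕ) : NumberField.RingOfIntegers K) ∈ v.asIdeal), (Literature.NumberTheory.PAdicHodge.fontainePstAdicCompletion v ℓ hv).IsDeRhamFramed (ρ.toLocal v)) → (∀ᶠ v : IsDedekindDomain.HeightOneSpectrum (NumberField.RingOfIntegers K) in cofinite, SatakeFrobCompatibleAt ι π.1 ρ v) → ∀ v : IsDedekindDomain.HeightOneSpectrum (NumberField.RingOfIntegers K), LocalGlobalCompatibleAt Rec ι π.1 ρ v) →
    ((∀ ρ : Literature.NumberTheory.GaloisRepresentations.FramedGaloisRep ℚ ℂ 2, ρ.toGaloisRep.IsIrreducible → Nonempty ((Matrix.ProjGenLinGroup.mk.comp ρ.toMonoidHom).range ≃* alternatingGroup (Fin 5)) → (∀ (φ : ℚ →+* ℝ) (c : Field.absoluteGaloisGroup ℚ), Literature.NumberTheory.GaloisRepresentations.IsComplexConjugation φ c → Matrix.GeneralLinearGroup.det (ρ c) = 1) → ∃ (hcpt : Literature.NumberTheory.Automorphic.isCompact_glFiniteIntegralLevel 2 ℚ) (π : Literature.NumberTheory.Automorphic.CuspidalAutomorphicRepData 2 ℚ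 hcpt), (∀ᶠ v : IsDedekindDomain.HeightOneSpectrum (NumberField.RingOfIntegers ℚ) in Filter.cofinite, ∃ α : Multiset ℂ, π.1.HasSatakeParamAt v α ∧ ρ.IsUnramifiedAt v ∧ ρ.HasFrobCharpolyAt v (Literature.NumberTheory.Automorphic.satakePolynomial α))) →
      _root_.Langlands) := by
  intro hN hW hB hC _hX F _ _
  refine ⟨hN F, fun 𝓡 n hn hcpt => ⟨?_, ?_⟩⟩
  · -- direction (A) at `𝓡`: the irreducible avatar of W_irr, its compatibility by C∀, uniqueness
    intro π hL ℓ _ ι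
    obtain ⟨ρ, hirr, hgeo, hρ⟩ := hW F n hcpt hn π hL ℓ ι
    have hcorr : Corresponds 𝓡 ι π.1 ρ := ⟨hρ, hC F 𝓡 n hcpt hn π hL ℓ ι ρ hirr hgeo hρ⟩
    exact ⟨ρ, hirr, hgeo, hcorr,
      fun ρ' hcorr' => isConjugate_of_satakeFrobCompatible π.1 ι hirr hρ hcorr'.1⟩
  · -- direction (B) at `𝓡`: B_w then C∀
    intro ℓ _ ι ρ hirr hgeo
    obtain ⟨π, hL, hρ⟩ := hB F n hcpt hn ℓ ι ρ hirr hgeo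
    exact ⟨π, hL, hρ, hC F 𝓡 n hcpt hn π hL ℓ ι ρ hirr hgeo hρ⟩

end Summit.Langlands.Langlands.Theorems.ParityBlindBianchiEvenArtinJunctionSplitSketch

/-! ## Part 3 — by-name certificate -/

namespace Summit.Langlands.Langlands.Theses.ParityBlindBianchi

/-- The glue item of the split, BY NAME, closed by the structural theorem through δ-unfolding. -/
theorem EvenArtinJunction_of_subs :
    ReciprocityDataNonempty → WeakExistenceIrreducible → WeakAutomorphy → PairCompatibilityAll →
      EvenArtinJunction :=
  Summit.Langlands.Langlands.Theorems.ParityBlindBianchiEvenArtinJunctionSplitSketch.evenArtinJunction_of_leaves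

/-- Converse records (BC2): the summit implies N, W_irr and B_w outright (projection at a datum supplied by
the non-vacuity conjunct; `IsGeometricFramed 𝓡 ρ` is definitionally the pinned clause). C∀ is a consequence
of the summit through the weak-to-strong transport of `Corresponds` along conjugacy (landed elsewhere for the
old shape, `NewtonPatchingWeakToStrong`); not re-proved here. -/
theorem leaves_of_langlands (hL : _root_.Langlands) :
    ReciprocityDataNonempty ∧ WeakExistenceIrreducible ∧ WeakAutomorphy := by
  refine ⟨fun K _ _ => (hL K).1, fun K _ _ n hcpt hn π hLalg ℓ _ ι => ?_, fun K _ _ n hcpt hn ℓ _ ι ρ hirr hgeo => ?_⟩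
  · obtain ⟨⟨𝓡⟩, hall⟩ := hL K
    obtain ⟨ρ, hirr, hgeo, hcorr, -⟩ := (hall 𝓡 n hn hcpt).1 π hLalg ℓ ι
    exact ⟨ρ, hirr, hgeo, hcorr.1⟩
  · obtain ⟨⟨𝓡⟩, hall⟩ := hL K
    obtain ⟨π, hLalg, hcorr⟩ := (hall 𝓡 n hn hcpt).2 ℓ ι ρ hirr hgeo
    exact ⟨π, hLalg, hcorr.1⟩

end Summit.Langlands.Langlands.Theses.ParityBlindBianchi

end
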